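import Mathlib.NumberTheory.DiophantineApproximation.Basic
import Mathlib.Analysis.SpecialFunctions.Log.Basic
import HarnessLib

/-!
# Near-resonant labels: lattice points close to the irrational line `n₁ = -r₀ d`

Zilber's Exponential-Algebraic Closedness, case ladder (host summit Schanuel, cell `pub-schanuel`,
seat 2, gen 13).  The critical-size family `x₂ = r₀x₀ + (1 - r₀)x₁`, `yⱼ = xⱼ + y₂` (`r₀ ∉ ℚ`) is
solved (see `ZilberEacNearResonantExistence`) along labels `n = (n₁ + d, n₁) ∈ ℤ²` whose
near-resonance defect `ε = r₀ d + n₁` is small and CONVERGES to a prescribed real number `ε*`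
while `d → ∞`.  This file supplies such labels (`exists_labels_tendsto`): for irrational `r₀` the
additive group `ℤ + r₀ℤ` has arbitrarily small positive elements with POSITIVE `r₀`-coefficient
(Dirichlet's approximation theorem, `Real.exists_int_int_abs_mul_sub_le`, plus the reflection
`1 - m₀ g`), whence every real number is approached by `r₀ d + n₁` with `d → +∞`.  It also records
the two scale facts `log d_k → ∞` and `(log d_k)^a / d_k → 0` used by THEOREM N.

HONEST FRAMING: bookkeeping lemmas; the cell `EC(3,2)` is OPEN; NOT Schanuel's conjecture;
EAC ⇏ SC.
-/

noncomputable section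

open Filter Topology

set_option linter.dupNamespace false

namespace Summit.Schanuel.Schanuel.Theorems

section Labels

/-- **Small positive elements of `ℤ + r₀ℤ` with positive `r₀`-coefficient.**  For irrational `r`
and `η > 0` there are integers `a > 0`, `b` with `0 < r a + b < η`.  (Dirichlet gives
`0 < |k r - j| ≤ 1/(N+1)`; if `k r - j < 0` use `1 - m₀ (j - k r)` with `m₀ = ⌊1/(j - kr)⌋`.)
[folklore] -/
theorem exists_pos_int_lt_combination {r : ℝ} (hr : Irrational r) {η : ℝ} (hη : 0 < η) :
    ∃ a b : ℤ, 0 < a ∧ 0 < r * a + b ∧ r * a + b < η := by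
  obtain ⟨N, hN⟩ := exists_nat_gt (1 / η)
  have hNpos : 0 < N := by
    rcases Nat.eq_zero_or_pos N with h | h
    · exfalso
      rw [h, Nat.cast_zero] at hN
      linarith [one_div_pos.2 hη]
    · exact h
  obtain ⟨j, k, hk0, -, hjk⟩ := Real.exists_int_int_abs_mul_sub_le r hNpos
  have hg0 : (k : ℝ) * r - j ≠ 0 := by
    intro h
    apply hr
    refine ⟨(j : ℚ) / k, ?_⟩
    have hk' : (k : ℝ) ≠ 0 := by exact_mod_cast hk0.ne'
    push_cast
    rw [div_eq_iff hk']
    linarith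
  have hsmall : |(k : ℝ) * r - j| < η := by
    refine hjk.trans_lt ?_
    rw [div_lt_iff₀ (by positivity)]
    have h1 : 1 / η * η = 1 := by field_simp
    nlinarith
  have hle1 : |(k : ℝ) * r - j| ≤ 1 := by
    refine hjk.trans ?_
    rw [div_le_one (by positivity)]
    linarith [(Nat.cast_nonneg N : (0 : ℝ) ≤ N)]
  rcases lt_or_gt_of_ne hg0 with hneg | hpos
  · -- reflect: `g' = j - k r ∈ (0, η)`, `h = 1 - m₀ g'`
    set g' : ℝ := (j : ℝ) - k * r with hg'
    have hg'pos : 0 < g' := by rw [hg']; linarith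
    have hg'lt : g' < η := by
      have : |(k : ℝ) * r - j| = g' := by rw [abs_of_neg hneg, hg']; ring
      linarith
    have hg'le1 : g' ≤ 1 := by
      have : |(k : ℝ) * r - j| = g' := by rw [abs_of_neg hneg, hg']; ring
      linarith
    set m₀ : ℤ := ⌊1 / g'⌋ with hm₀
    have hm₀le : (m₀ : ℝ) ≤ 1 / g' := Int.floor_le _
    have hm₀lt : 1 / g' < (m₀ : ℝ) + 1 := Int.lt_floor_add_one _
    have hm₀pos : 0 < m₀ := by
      have : (1 : ℝ) ≤ 1 / g' := by rw [le_div_iff₀ hg'pos]; linarith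
      have h' : (0 : ℝ) < (m₀ : ℝ) + 1 - 1 := by linarith
      exact_mod_cast (by linarith : (0 : ℝ) < m₀)
    have hprod1 : (m₀ : ℝ) * g' ≤ 1 := by
      have := mul_le_mul_of_nonneg_right hm₀le hg'pos.le
      rwa [one_div, inv_mul_cancel₀ hg'pos.ne'] at this
    have hprod2 : 1 < ((m₀ : ℝ) + 1) * g' := by
      have := mul_lt_mul_of_pos_right hm₀lt hg'pos
      rwa [one_div, inv_mul_cancel₀ hg'pos.ne'] at this
    have hh0 : 1 - (m₀ : ℝ) * g' ≠ 0 := by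
      intro h
      apply hr
      have hmk : ((m₀ * k : ℤ) : ℝ) ≠ 0 := by
        have : (0 : ℤ) < m₀ * k := mul_pos hm₀pos hk0
        exact_mod_cast this.ne'
      refine ⟨((m₀ * j - 1 : ℤ) : ℚ) / ((m₀ * k : ℤ) : ℚ), ?_⟩
      push_cast at hmk ⊢
      rw [div_eq_iff hmk]
      rw [hg'] at h
      linarith
    refine ⟨m₀ * k, 1 - m₀ * j, mul_pos hm₀pos hk0, ?_, ?_⟩
    · have e : r * ((m₀ * k : ℤ) : ℝ) + ((1 - m₀ * j : ℤ) : ℝ) = 1 - (m₀ : ℝ) * g' := by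
        rw [hg']; push_cast; ring
      rw [e]
      exact lt_of_le_of_ne (by linarith) (Ne.symm hh0)
    · have e : r * ((m₀ * k : ℤ) : ℝ) + ((1 - m₀ * j : ℤ) : ℝ) = 1 - (m₀ : ℝ) * g' := by
        rw [hg']; push_cast; ring
      rw [e]
      nlinarith
  · refine ⟨k, -j, hk0, ?_, ?_⟩
    · push_cast; linarith
    · push_cast
      rw [abs_of_pos hpos] at hsmall
      linarith

/-- **Labels near a prescribed defect, with `d` large.**  For irrational `r`, every real `ε*`,
`η > 0` and `K` there are `d ≥ K` and `n₁ ∈ ℤ` with `|r d + n₁ - ε*| < η`. [folklore] -/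
theorem exists_label_near {r : ℝ} (hr : Irrational r) (εst : ℝ) {η : ℝ} (hη : 0 < η) (K : ℕ) :
    ∃ d : ℕ, K ≤ d ∧ ∃ n₁ : ℤ, |r * d + n₁ - εst| < η := by
  have hη' : 0 < min η (1 / ((K : ℝ) + 1)) := lt_min hη (by positivity)
  obtain ⟨a, b, ha, hg0, hgη⟩ := exists_pos_int_lt_combination hr hη'
  set g : ℝ := r * a + b with hg
  have hgη1 : g < η := hgη.trans_le (min_le_left _ _)
  have hgK : g < 1 / ((K : ℝ) + 1) := hgη.trans_le (min_le_right _ _)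
  -- shift the target by a natural number `M` so that it is `≥ 1`
  obtain ⟨M, hM⟩ := exists_nat_ge (1 - εst)
  set m : ℤ := ⌊(εst + M) / g⌋ with hm
  have hmle : (m : ℝ) ≤ (εst + M) / g := Int.floor_le _
  have hmlt : (εst + M) / g < (m : ℝ) + 1 := Int.lt_floor_add_one _
  have h1 : (m : ℝ) * g ≤ εst + M := by
    have := mul_le_mul_of_nonneg_right hmle hg0.le
    rwa [div_mul_cancel₀ _ hg0.ne'] at this
  have h2 : εst + M < ((m : ℝ) + 1) * g := by
    have := mul_lt_mul_of_pos_right hmlt hg0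
    rwa [div_mul_cancel₀ _ hg0.ne'] at this
  -- `m > K`
  have hmK : (K : ℝ) < m := by
    have hquot : (K : ℝ) + 1 < (εst + M) / g := by
      rw [lt_div_iff₀ hg0]
      have : ((K : ℝ) + 1) * g < 1 := by
        have := mul_lt_mul_of_pos_left hgK (show (0 : ℝ) < (K : ℝ) + 1 by positivity)
        rwa [mul_one_div_cancel (by positivity)] at this
      linarith
    linarith
  have hm0 : 0 ≤ m := by exact_mod_cast ((Nat.cast_nonneg K).trans hmK.le : (0 : ℝ) ≤ m)
  have hma0 : 0 ≤ m * a := mul_nonneg hm0 ha.le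
  refine ⟨(m * a).toNat, ?_, m * b - M, ?_⟩
  · have hK' : (K : ℤ) ≤ m * a := by
      have hmK' : (K : ℤ) ≤ m := by exact_mod_cast hmK.le
      calc (K : ℤ) ≤ m * 1 := by rw [mul_one]; exact hmK'
        _ ≤ m * a := mul_le_mul_of_nonneg_left (by omega) hm0
    omega
  · have e : (((m * a).toNat : ℕ) : ℝ) = (m : ℝ) * a := by
      have : (((m * a).toNat : ℕ) : ℤ) = m * a := Int.toNat_of_nonneg hma0
      exact_mod_cast this
    rw [e]
    have e2 : r * ((m : ℝ) * a) + ((m * b - M : ℤ) : ℝ) - εst = (m : ℝ) * g - (εst + M) := by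
      rw [hg]; push_cast; ring
    rw [e2, abs_lt]
    constructor <;> nlinarith

/-- **Near-resonant labels with convergent defect.**  For irrational `r` and every real `ε*` there
are labels `d_k → ∞` in `ℕ` and `n₁(k) ∈ ℤ` with `r d_k + n₁(k) → ε*`. [folklore] -/
theorem exists_labels_tendsto {r : ℝ} (hr : Irrational r) (εst : ℝ) :
    ∃ (d : ℕ → ℕ) (n₁ : ℕ → ℤ), Tendsto d atTop atTop ∧
      Tendsto (fun k => r * d k + n₁ k) atTop (𝓝 εst) := by
  have h : ∀ k : ℕ, ∃ d : ℕ, k ≤ d ∧ ∃ n₁ : ℤ, |r * d + n₁ - εst| < 1 / ((k : ℝ) + 1) :=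
    fun k => exists_label_near hr εst (by positivity) k
  choose d hdk n₁ hn₁ using h
  refine ⟨d, n₁, tendsto_atTop_mono hdk tendsto_id, ?_⟩
  rw [tendsto_iff_norm_sub_tendsto_zero]
  refine squeeze_zero (fun k => norm_nonneg _) (fun k => ?_) tendsto_one_div_add_atTop_nhds_zero_nat
  rw [Real.norm_eq_abs]
  exact (hn₁ k).le

end Labels

/-! ## The two scales `log d_k` and `d_k` -/

section Scales

/-- `log d_k → ∞` along `d_k → ∞`. [folklore] -/
theorem tendsto_log_natCast_comp {d : ℕ → ℕ} (hd : Tendsto d atTop atTop) :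
    Tendsto (fun k => Real.log (d k)) atTop atTop :=
  Real.tendsto_log_atTop.comp (tendsto_natCast_atTop_atTop.comp hd)

/-- `(log d_k)^a / d_k → 0` along `d_k → ∞`. [folklore] -/
theorem tendsto_log_pow_div_natCast_comp {d : ℕ → ℕ} (hd : Tendsto d atTop atTop) (a : ℕ) :
    Tendsto (fun k => Real.log (d k) ^ a / (d k : ℝ)) atTop (𝓝 0) := by
  have h := (Real.tendsto_pow_log_div_mul_add_atTop 1 0 a one_ne_zero).comp
    (tendsto_natCast_atTop_atTop.comp hd)
  refine h.congr fun k => ?_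
  simp only [Function.comp_apply, one_mul, add_zero]

end Scales

end Summit.Schanuel.Schanuel.Theorems

end
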